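import Summits.ValiantsHypothesis.ValiantsHypothesis.Theorems.NewtonUnitEquationsTwoProductsPermutationTypeWeightOrder

/-!
# Route NewtonUnitEquations — crux `TwoProducts` (stmt-ValiantsHypothesis-5906): the PERMUTATION-TYPE LAW, part R3b —
# linear weights, linear forms, moments, the truncated logarithm and the LIFTED log-linearisation `lifted_minUnequal`

Parts (B, end)/(C)/(D1) of the ideator's `Lifted` toolkit @47fa98797544: the real Euler derivation on monomials and the linear weight
`lwt θ` (`coeff_eulerDerivation`, `one_le_lwt_of_ne_zero`), linear forms `lin a = Σ a_i Y_i`, moments `mom a κ = ∏ a_i^{κ_i}`, degree `deg`,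
the truncated logarithm `logTrunc c d R` of `∏(1+U_j)/∏(1+V_j)` with its coefficient formula
`(−1)^{k+1}/k · multinomial(κ) · (Σ_j c_j^κ − Σ_j d_j^κ)` (`coeff_logTrunc`, `mem_support_logTrunc_iff`), the lifted difference
`liftG c d = ∏(1+U_j) − ∏(1+V_j)` and **`lifted_minUnequal`**: a strict `θ`-minimum of the support of `liftG` is the strict `θ`-minimal
UNEQUAL MOMENT.  Over R3a (`…PermutationTypeWeightOrder`). [folklore]

PORT NOTE.  Theorems-side port (val-lit port pool, seat val-port-2; crit-3 RE-READ #15 = R3 PASS by name) of the ideator's turnkey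
`turnkey/NewtonUnitEquationsTwoProductsPermutationTypeLaw.lean` sha16 ffb21fb250e86da7 = tree
`Cruxes/TwoProducts/Lines/relation_ladder_turnkey_PermutationTypeLaw.lean` @948c771086b6 (1137 l.), split by the 400-line rule into FOUR
files, texts VERBATIM, cut at the author's part boundaries: (R3a) `…PermutationTypeWeightOrder.lean` = Parts A/B (additive-weight
strict minima, Euler/Wronskian congruences); (R3b) `…PermutationTypeLifted.lean` = Parts B-end/C/D1 (`lwt`, linear forms, moments,
truncated logarithm, `liftG`, `lifted_minUnequal`); (R3c) `…PermutationTypePushForward.lean` = Parts D2/D3 (`phi`, `piE`, `InjDeg`,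
the planar instance, `minUnequal_of_visible`); (R3d) `…PermutationTypeLaw.lean` = Part D4 + statement (`pencil_param`, the count,
`IsBm`, `visibleCount_of_isBm`).  Helper mode (`--supports stmt-ValiantsHypothesis-5906 --as helper`); nothing here closes the
line's residual `ResidualLawV6`, `PlanarCellBound`, the crux `TwoProducts` or `VP ≠ VNP`; no summit statement is proved.
-/

noncomputable section

-- Sub = Summit single-conjunct layout: the duplicated namespace component is mandated by the tree.
set_option linter.dupNamespace false

namespace Summit.ValiantsHypothesis.ValiantsHypothesis.Theorems.NewtonUnitEquations.TwoProducts.PermutationType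
open scoped BigOperators
open MvPolynomial

variable {σ : Type*} [Fintype σ] [DecidableEq σ]


omit [Fintype σ] [DecidableEq σ] in
/-- One summand of the real Euler derivation on a monomial. [folklore] -/
theorem monomial_tsub_smul_wX (θ : σ → ℝ) (s : σ →₀ ℕ) (i : σ) :
    (monomial (s - Finsupp.single i 1) ((s i : ℕ) : ℂ) : MvPolynomial σ ℂ) •
        (((θ i : ℝ) : ℂ) • (X i : MvPolynomial σ ℂ)) =
      (((θ i : ℝ) : ℂ) * ((s i : ℕ) : ℂ)) • monomial s (1 : ℂ) := by
  rw [smul_eq_mul, mul_smul_comm, mul_smul]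
  congr 1
  by_cases h : s i = 0
  · simp [h]
  · rw [X, monomial_mul, mul_one,
      tsub_add_cancel_of_le (Finsupp.single_le_iff.mpr (Nat.one_le_iff_ne_zero.mpr h)),
      smul_monomial, smul_eq_mul, mul_one]

/-- The real linear weight `q ↦ Σ θ_i q_i`. [folklore] -/
def lwt (θ : σ → ℝ) (q : σ →₀ ℕ) : ℝ := ∑ i, θ i * ((q i : ℕ) : ℝ)

omit [DecidableEq σ] in
/-- `lwt_add` (R3 toolkit). [folklore] -/
theorem lwt_add (θ : σ → ℝ) (p q : σ →₀ ℕ) : lwt θ (p + q) = lwt θ p + lwt θ q := by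
  unfold lwt
  rw [← Finset.sum_add_distrib]
  refine Finset.sum_congr rfl fun i _ => ?_
  simp only [Finsupp.coe_add, Pi.add_apply]
  push_cast
  ring

omit [DecidableEq σ] in
/-- A weight with all `θ_i ≥ 1` is `≥ 1` on nonzero exponents. [folklore] -/
theorem one_le_lwt_of_ne_zero (θ : σ → ℝ) (hθ : ∀ i, 1 ≤ θ i) (p : σ →₀ ℕ) (hp : p ≠ 0) :
    1 ≤ lwt θ p := by
  obtain ⟨i, hi⟩ : ∃ i, p i ≠ 0 := by
    by_contra h
    push Not at h
    exact hp (Finsupp.ext fun i => by simpa using h i)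
  unfold lwt
  have h1 : (1 : ℝ) ≤ θ i * ((p i : ℕ) : ℝ) := by
    have : (1 : ℝ) ≤ ((p i : ℕ) : ℝ) := by exact_mod_cast Nat.one_le_iff_ne_zero.mpr hi
    nlinarith [hθ i]
  calc (1 : ℝ) ≤ θ i * ((p i : ℕ) : ℝ) := h1
    _ ≤ ∑ k, θ k * ((p k : ℕ) : ℝ) :=
        Finset.single_le_sum (f := fun k => θ k * ((p k : ℕ) : ℝ))
          (fun k _ => mul_nonneg (by linarith [hθ k]) (Nat.cast_nonneg _)) (Finset.mem_univ i)

/-- Coefficient formula for the real Euler derivation `θ_D = ∑ i, θ i • X i ∂_i`: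
`coeff q (θ_D A) = (Σ θ_i q_i) * coeff q A`. [folklore] -/
theorem coeff_eulerDerivation (θ : σ → ℝ) (A : MvPolynomial σ ℂ) (q : σ →₀ ℕ) :
    coeff q (MvPolynomial.mkDerivation ℂ
        (fun i : σ => ((θ i : ℝ) : ℂ) • (X i : MvPolynomial σ ℂ)) A) =
      ((lwt θ q : ℝ) : ℂ) * coeff q A := by
  induction A using MvPolynomial.induction_on' with
  | monomial s a =>
    rw [MvPolynomial.mkDerivation_monomial, Finsupp.sum_fintype _ _ (fun i => by simp)]
    rw [Finset.sum_congr rfl fun i _ => monomial_tsub_smul_wX θ s i, ← Finset.sum_smul, smul_smul,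
      coeff_smul, coeff_monomial, coeff_monomial]
    split_ifs with h
    · subst h
      unfold lwt
      push_cast
      rw [smul_eq_mul]
      ring
    · rw [smul_zero, mul_zero]
  | add p q hp hq => rw [map_add, coeff_add, coeff_add, hp, hq, mul_add]

omit [Fintype σ] [DecidableEq σ] in
/-- `coeff_zero_prod_eq_one` (R3 toolkit). [folklore] -/
theorem coeff_zero_prod_eq_one {n : ℕ} (u : Fin n → MvPolynomial σ ℂ)
    (hu : ∀ i, coeff 0 (u i) = 1) : coeff 0 (∏ i, u i) = 1 := by
  rw [← constantCoeff_eq, map_prod]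
  exact Finset.prod_eq_one fun i _ => by rw [constantCoeff_eq]; exact hu i

omit [Fintype σ] [DecidableEq σ] in
/-- The truncated log-difference is constant-free. [folklore] -/
theorem coeff_zero_logTrunc {n : ℕ} (u v : Fin n → MvPolynomial σ ℂ)
    (hu : ∀ i, coeff 0 (u i) = 1) (hv : ∀ i, coeff 0 (v i) = 1) (R : ℕ) :
    coeff 0 (∑ r ∈ Finset.Icc 1 R, ((-1 : ℂ) ^ (r + 1) / (r : ℂ)) •
        (∑ i, (u i - 1) ^ r - ∑ i, (v i - 1) ^ r)) = 0 := by
  have hu' : ∀ i, constantCoeff (u i) = 1 := fun i => by rw [constantCoeff_eq]; exact hu i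
  have hv' : ∀ i, constantCoeff (v i) = 1 := fun i => by rw [constantCoeff_eq]; exact hv i
  rw [← constantCoeff_eq, map_sum]
  refine Finset.sum_eq_zero fun r _ => ?_
  rw [constantCoeff_smul, map_sub, map_sum, map_sum]
  simp [hu', hv']



/-! ## Part C: linear forms, moments, and the truncated logarithm's coefficients -/

/-- The linear form `Σ a_i Y_i`. [folklore] -/
def lin (a : σ → ℂ) : MvPolynomial σ ℂ := ∑ i, a i • X i

/-- The moment `a^κ = ∏ a_i ^ κ_i`. [folklore] -/
def mom (a : σ → ℂ) (κ : σ →₀ ℕ) : ℂ := ∏ i, a i ^ κ i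

/-- Total degree of an exponent. [folklore] -/
def deg (κ : σ →₀ ℕ) : ℕ := κ.sum fun _ k => k

omit [DecidableEq σ] in
/-- `deg_eq_sum` (R3 toolkit). [folklore] -/
theorem deg_eq_sum (κ : σ →₀ ℕ) : deg κ = ∑ i, κ i := by
  unfold deg; exact Finsupp.sum_fintype _ _ (fun _ => rfl)

omit [DecidableEq σ] in
/-- `deg_eq_zero_iff` (R3 toolkit). [folklore] -/
theorem deg_eq_zero_iff (κ : σ →₀ ℕ) : deg κ = 0 ↔ κ = 0 := by
  rw [deg_eq_sum]
  constructor
  · intro h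
    ext i
    have := (Finset.sum_eq_zero_iff.mp h) i (Finset.mem_univ i)
    simpa using this
  · rintro rfl; simp

omit [DecidableEq σ] in
/-- `coeff_lin_pow` (R3 toolkit). [folklore] -/
theorem coeff_lin_pow (a : σ → ℂ) (κ : σ →₀ ℕ) (n : ℕ) :
    coeff κ (lin a ^ n) = if deg κ = n then (κ.multinomial : ℂ) * mom a κ else 0 := by
  unfold lin mom deg
  rw [coeff_linearCombination_X_pow_of_fintype]
  split_ifs with h
  · rw [Finsupp.prod_fintype _ _ (fun i => by simp)]
  · rfl

omit [DecidableEq σ] in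
/-- `coeff_zero_lin` (R3 toolkit). [folklore] -/
theorem coeff_zero_lin (a : σ → ℂ) : coeff 0 (lin a) = 0 := by
  have := coeff_lin_pow a 0 1
  rw [pow_one] at this
  rw [this, if_neg]
  rw [deg_eq_sum]; simp

omit [DecidableEq σ] in
/-- `coeff_zero_one_add_lin` (R3 toolkit). [folklore] -/
theorem coeff_zero_one_add_lin (a : σ → ℂ) : coeff 0 (1 + lin a) = 1 := by
  rw [coeff_add, coeff_zero_lin, coeff_zero_one, add_zero]

omit [Fintype σ] [DecidableEq σ] in
/-- `multinomial_cast_ne_zero` (R3 toolkit). [folklore] -/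
theorem multinomial_cast_ne_zero (κ : σ →₀ ℕ) : (κ.multinomial : ℂ) ≠ 0 := by
  rw [Finsupp.multinomial_eq]
  exact Nat.cast_ne_zero.mpr (Nat.pos_iff_ne_zero.mp (Nat.multinomial_pos _ _))

/-- The truncated log-difference of the chain, for tails `lin (c j)`, `lin (d j)`. [folklore] -/
def logTrunc {m : ℕ} (c d : Fin m → σ → ℂ) (R : ℕ) : MvPolynomial σ ℂ :=
  ∑ r ∈ Finset.Icc 1 R, ((-1 : ℂ) ^ (r + 1) / (r : ℂ)) •
    (∑ j, ((1 + lin (c j)) - 1) ^ r - ∑ j, ((1 + lin (d j)) - 1) ^ r)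

omit [DecidableEq σ] in
/-- `coeff_logTrunc` (R3 toolkit). [folklore] -/
theorem coeff_logTrunc {m : ℕ} (c d : Fin m → σ → ℂ) (R : ℕ) (κ : σ →₀ ℕ) (h1 : 1 ≤ deg κ)
    (hR : deg κ ≤ R) :
    coeff κ (logTrunc c d R) =
      ((-1 : ℂ) ^ (deg κ + 1) / (deg κ : ℂ)) * ((κ.multinomial : ℂ) *
        (∑ j, mom (c j) κ - ∑ j, mom (d j) κ)) := by
  unfold logTrunc
  simp only [add_sub_cancel_left]
  rw [coeff_sum]
  rw [Finset.sum_eq_single (deg κ)]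
  · rw [coeff_smul, coeff_sub, coeff_sum, coeff_sum, smul_eq_mul]
    congr 1
    simp only [coeff_lin_pow, if_true]
    rw [mul_sub, Finset.mul_sum, Finset.mul_sum]
  · intro r _ hr
    rw [coeff_smul, coeff_sub, coeff_sum, coeff_sum, smul_eq_mul]
    simp only [coeff_lin_pow, if_neg (Ne.symm hr), Finset.sum_const_zero, sub_zero, mul_zero]
  · intro h
    exfalso; exact h (Finset.mem_Icc.mpr ⟨h1, hR⟩)

omit [DecidableEq σ] in
/-- `mem_support_logTrunc_iff` (R3 toolkit). [folklore] -/
theorem mem_support_logTrunc_iff {m : ℕ} (c d : Fin m → σ → ℂ) (R : ℕ) (κ : σ →₀ ℕ) (h1 : 1 ≤ deg κ)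
    (hR : deg κ ≤ R) :
    κ ∈ (logTrunc c d R).support ↔ ∑ j, mom (c j) κ ≠ ∑ j, mom (d j) κ := by
  rw [mem_support_iff, coeff_logTrunc c d R κ h1 hR]
  have hk : (deg κ : ℂ) ≠ 0 := Nat.cast_ne_zero.mpr (by omega)
  have hc : ((-1 : ℂ) ^ (deg κ + 1) / (deg κ : ℂ)) ≠ 0 :=
    div_ne_zero (pow_ne_zero _ (neg_ne_zero.mpr one_ne_zero)) hk
  rw [mul_ne_zero_iff, mul_ne_zero_iff, sub_ne_zero]
  exact ⟨fun h => h.2.2, fun h => ⟨hc, multinomial_cast_ne_zero κ, h⟩⟩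

omit [DecidableEq σ] in
/-- `mom_zero` (R3 toolkit). [folklore] -/
theorem mom_zero (a : σ → ℂ) : mom a 0 = 1 := by unfold mom; simp

omit [DecidableEq σ] in
/-- `deg κ ≤ Σ θ_i κ_i` when all `θ_i ≥ 1`. [folklore] -/
theorem deg_le_lwt (θ : σ → ℝ) (hθ : ∀ i, 1 ≤ θ i) (κ : σ →₀ ℕ) : (deg κ : ℝ) ≤ lwt θ κ := by
  rw [deg_eq_sum]; unfold lwt; push_cast
  exact Finset.sum_le_sum fun i _ => by nlinarith [hθ i, (Nat.cast_nonneg (κ i) : (0:ℝ) ≤ (κ i : ℝ))]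

/-! ## Part D1: the lifted log-linearisation — a strict `θ`-minimum of the lifted support is the strict `θ`-minimal
unequal moment -/

/-- The lifted difference of products `∏ (1 + Σ c_{ji} Y_i) − ∏ (1 + Σ d_{ji} Y_i)`. [folklore] -/
def liftG {m : ℕ} (c d : Fin m → σ → ℂ) : MvPolynomial σ ℂ :=
  ∏ j, (1 + lin (c j)) - ∏ j, (1 + lin (d j))

/-- `lifted_minUnequal` (R3 toolkit). [folklore] -/
theorem lifted_minUnequal {m : ℕ} (θ : σ → ℝ) (hθ : ∀ i, 1 ≤ θ i) (c d : Fin m → σ → ℂ) (κ₀ : σ →₀ ℕ)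
    (h : κ₀ ∈ (liftG c d).support ∧ ∀ κ ∈ (liftG c d).support, κ ≠ κ₀ → lwt θ κ₀ < lwt θ κ) :
    (∑ j, mom (c j) κ₀ ≠ ∑ j, mom (d j) κ₀) ∧
      ∀ κ : σ →₀ ℕ, κ ≠ κ₀ → (∑ j, mom (c j) κ ≠ ∑ j, mom (d j) κ) → lwt θ κ₀ < lwt θ κ := by
  have hadd := lwt_add θ
  have hpos := one_le_lwt_of_ne_zero θ hθ
  set R : ℕ := ⌊lwt θ κ₀⌋₊ + 1 with hRdef
  have hR : lwt θ κ₀ < (R : ℝ) := by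
    rw [hRdef]; push_cast; exact Nat.lt_floor_add_one _
  have hu : ∀ j, coeff 0 (1 + lin (c j)) = 1 := fun j => coeff_zero_one_add_lin (c j)
  have hv : ∀ j, coeff 0 (1 + lin (d j)) = 1 := fun j => coeff_zero_one_add_lin (d j)
  have key := strictMin_sub_iff_of_congr (lwt θ) hadd hpos
    (MvPolynomial.mkDerivation ℂ fun i : σ => ((θ i : ℝ) : ℂ) • (X i : MvPolynomial σ ℂ))
    (coeff_eulerDerivation θ) (∏ j, (1 + lin (c j))) (∏ j, (1 + lin (d j))) (logTrunc c d R)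
    (coeff_zero_prod_eq_one _ hu) (coeff_zero_prod_eq_one _ hv) (coeff_zero_logTrunc _ _ hu hv R) R
    (coeff_wronskian_congr _ hadd hpos _ _ _ hu hv R) κ₀ hR
  have h' : κ₀ ∈ (logTrunc c d R).support ∧ ∀ κ ∈ (logTrunc c d R).support, κ ≠ κ₀ → lwt θ κ₀ < lwt θ κ :=
    key.mp h
  -- degree facts
  have hκ₀ne : κ₀ ≠ 0 := by
    intro h0
    have := mem_support_iff.mp h.1
    rw [h0] at this
    apply this
    unfold liftG
    rw [coeff_sub, coeff_zero_prod_eq_one _ hu, coeff_zero_prod_eq_one _ hv, sub_self]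
  have hdeg1 : 1 ≤ deg κ₀ := by
    rcases Nat.eq_zero_or_pos (deg κ₀) with h0 | h0
    · exact absurd ((deg_eq_zero_iff κ₀).mp h0) hκ₀ne
    · exact h0
  have hdegR : deg κ₀ ≤ R := by
    have := deg_le_lwt θ hθ κ₀
    have : (deg κ₀ : ℝ) < R := lt_of_le_of_lt this hR
    exact_mod_cast this.le
  refine ⟨(mem_support_logTrunc_iff c d R κ₀ hdeg1 hdegR).mp h'.1, fun κ hne hneq => ?_⟩
  by_contra hle
  push Not at hle
  have hκne : κ ≠ 0 := by
    rintro rfl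
    apply hneq
    simp [mom_zero]
  have hk1 : 1 ≤ deg κ := by
    rcases Nat.eq_zero_or_pos (deg κ) with h0 | h0
    · exact absurd ((deg_eq_zero_iff κ).mp h0) hκne
    · exact h0
  have hkR : deg κ ≤ R := by
    have h1 := deg_le_lwt θ hθ κ
    have : (deg κ : ℝ) < R := by linarith
    exact_mod_cast this.le
  have hmem : κ ∈ (logTrunc c d R).support := (mem_support_logTrunc_iff c d R κ hk1 hkR).mpr hneq
  linarith [h'.2 κ hmem hne]

end Summit.ValiantsHypothesis.ValiantsHypothesis.Theorems.NewtonUnitEquations.TwoProducts.PermutationType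

end
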